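import Summits.QuantumFields.YangMills.Theorems.BalabanUVNodesPortS1P0CPreckSymm
import Summits.QuantumFields.YangMills.Theorems.BalabanUVNodesPortS1ClassTwins
import Summits.QuantumFields.YangMills.Theorems.BalabanUVNodesN09GaugeFixingTermContinuousOnAdmissible
import Literature.MathematicalPhysics.QuantumFieldTheory.Balaban1983to89.BlockAveragingFederbushAnalytic

/-!
# NODE O port PT-A — THE GAUGE-FIXING `C²` ROW OF (M7-sym) DISCHARGED: the gauge-fixing function of record `G(V′V^{(k)}) = recordGf Vk` ((2.5)) is `C^∞` at
# `B′ = 0` at every background whose staircase families are Federbush-admissible (in particular at every plaquette-small background and at every point of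
# print's ε₀-class), so the symmetry of the (2.11) matrix `recordPreckLoc` (the `IsHermitian` half of `RegClassP5`'s `PosDef`) holds AT EVERY CLASS POINT
# CONDITIONALLY ON THE ONE P0-ℝ ROW «`x ↦ A(U_k(V′_x V_B))` is `C²` at `0`» ONLY

Cell `ym-nodeO-ideate`, porter seat `ymgap-nodeO-port-PTA-1` (payload gen 12 ∕ lineage g13); `--kind proof --supports stmt-QuantumFields-27930 --as helper`; count-neutral.
[I] = [Balaban1987RG1]; [15] = [Balaban1985Variational].  Docket ★★★ director-ym №664 (2) — this lineage's LOCATING MEMO (M6)∕(M7) (`Lines/pta_residueW-LOCATING-M6-M7-v1.md`):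
row (M7-sym-b) «typable tonight, no letter, no print debt».

WHY.  ✓`isHermitian_recordPreckLoc_of_small` (✓p829227, `…PortS1P0CPreckSymm` §3) gives the `IsHermitian` conjunct of (P5)∕`RegClassP5`'s `Matrix.PosDef` at every (0.4)-guarded background
MODULO two displayed `C²` rows: (a) `ContDiffAt ℝ 2 (recordAUk F k K εbg Vk) 0` — the Wilson action through the level-`k` selector along the chart, P0-ℝ content ([15] Prop. 9 at `V₀ = Vk`);
(b) `ContDiffAt ℝ 2 (recordGf F k K Vk) 0` — the gauge-fixing function (2.5) `Σ_y Σ_{x ∈ B(y)∖y} [1 − Re tr U(y,x)]` of [I] (0.17)∕(0.19) read along the chart `V′V^{(k)} = pert Vk x`, through the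
AVERAGED CONTOUR VARIABLES (0.11) `U(y,x) = M({U(Γ)}_{Γ ∈ G(y,x)})` with Federbush's implicit mean `M` (0.10).  Row (b) is an explicit-map statement: print's «we assume that it [M] is an
analytic function» (p.253) is PROVED in the tree for (0.10) (lit ✓`FederbushMean.analyticAt_fedSol`, ✓`analyticAt_fedMeanGc_of_unitary`, ✓`fedM_eq_fedMeanGc`), the staircase transporters
are finite products of the chart's bond matrices (lit ✓`Node00.coe_holAt`∕`contDiff_holM`, ✓`contDiff_coe_pert_apply`), and on admissible families the tree's total `holTo` IS the mean
(✓`holTo_of_adm`; admissibility is OPEN, N09 ✓`isOpen_setOf_adm_stairHol`, and holds on small fields, N09 ✓`adm_stairHol_of_plaqSmall`).  THIS FILE proves row (b) and re-keys the symmetry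
brick on row (a) alone, at every plaquette-small background and at every point of the ε₀-class (class-point smallness from ✓`…PortS1ClassTwins`).

WHAT IS PROVED (theorems only; 0 `def`; 0 `sorry`; standard axioms).
* §1 ★ `contDiffAt_coe_holTo_comp_of_adm` — ONE-CONTOUR `C^∞` BRICK (any `N`, any level): for any map `Φ : E → SU(N)^{bonds_j}` from a real normed space, continuous at `x₀` with `C^∞` bond
  matrices, if the staircase family of `Φ x₀` at `(y, x′)` is admissible then `x ↦ ↑U(y,x′)(Φ x)` is `C^∞` at `x₀` (near `x₀` it is `fedMeanGc 0` of the enumerated staircase family — analytic).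
* §2 `recordGf_eq_sum`, ★★ `contDiffAt_recordGf_of_adm`, ★★ `contDiffAt_recordGf_of_plaqSmall` — ROW (b): `recordGf Vk` is `C^∞` at `0` whenever every staircase family of `Vk` is admissible, in
  particular whenever `Vk` is `a`-plaquette-small with `((d·L)²∕4)·a < δ_N`.
* §3 ★★ `isHermitian_recordPreckLoc_of_plaqSmall_of_contDiffAt` — symmetry of `recordPreckLoc … Vk (hopLinGraph Vk)` at every plaquette-small, (0.4)-guarded `Vk` from ROW (a) ALONE;
  ★★★ `isHermitian_recordPreckLoc_portVkAx_of_inRegClass` — AT EVERY POINT `B` OF PRINT's ε₀-CLASS (`ε₀ ≤ 1∕(53581824·L⁶)`, `2ε₀ ≤ ε₁`, TokE at `ε₁` as ✓`…ClassTwins` displays it):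
  `(recordPreckLoc F k K a₀ (portVkAx … B) (hopLinGraph … (portVkAx … B))).IsHermitian` ⇐ `ContDiffAt ℝ 2 (recordAUk F k K a₀ (portVkAx … B)) 0` — the (M7-sym) half of `RegClassP5` is now a
  theorem modulo the ONE P0-ℝ row at class points.

HONEST FRAMING.  Calculus over the tree's own analytic Federbush mean and holonomy products; row (a) (P0-ℝ: smooth dependence of the level-`k` minimiser on the coarse field at every class point,
[15] Prop. 9) is DISPLAYED, NOT discharged; nothing of Bałaban's RG estimates asserted, ported or discharged; (M7-pos)∕(M7-up)∕(M6)∕`stub_P0C` untouched; `RegClassP5`, `ClassP2Reg`,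
`P0HolExtAtRecordGL` inhabited NOWHERE; ⟨27930⟩ OPEN 2∕7 · no claim; ⟨26900⟩ 0∕4; NODE O 0∕1; COUNT 8∕28 · K 1∕4 UNMOVED; finite `𝕋⁴_{L^K}` at fixed ε — NOT continuum ∕ OS; **the Yang–Mills
mass gap (Clay) is NOT proved by any of this.**  No `sorry`, no `def`, no `instance`; standard axioms only.
-/

noncomputable section

open scoped BigOperators Matrix.Norms.L2Operator Topology

namespace Summit.QuantumFields.YangMills.Theorems.BalabanUVNodesPortS1

open Summit.QuantumFields.YangMills.Theorems.K0RecordFormatNames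
open Summit.QuantumFields.YangMills.BalabanUVNodes
open Literature.MathematicalPhysics.QuantumFieldTheory.Balaban1983to89
open Literature.MathematicalPhysics.QuantumFieldTheory.Balaban1983to89.Node00
open Literature.MathematicalPhysics.QuantumFieldTheory.Balaban1983to89.T4Continuum (T4Family holAt walk stairWord)
open Literature.MathematicalPhysics.QuantumFieldTheory.Balaban1983to89.BlockAveraging (Small)
open Literature.MathematicalPhysics.QuantumFieldTheory.Balaban1983to89.ExpMeanLog (expMeanLogSU)
open Literature.MathematicalPhysics.QuantumFieldTheory.Balaban1983to89.BlockAveragingTwoLevel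
open Literature.MathematicalPhysics.QuantumFieldTheory.Balaban1983to89.FederbushMean
open _root_.Matrix _root_.Filter

/-! ## §1  One averaged contour variable along a smooth chart: `C^∞` where its staircase family is admissible -/

section Contour

variable {N : ℕ} [NeZero N] {P : Params} {j : ℕ}
variable {E : Type*} [NormedAddCommGroup E] [NormedSpace ℝ E]

/-- ★ **THE ONE-CONTOUR `C^∞` BRICK**: if `Φ : E → SU(N)^{bonds_j}` is continuous at `x₀` with `C^∞` bond matrices at `x₀`, and the staircase family `{U(Γ^σ_{y,x′})}_σ` of `Φ x₀` is
Federbush-admissible, then the averaged contour variable `x ↦ ↑U(y,x′)(Φ x)` ((0.11), the tree's total `holTo`) is `C^∞` at `x₀`: near `x₀` admissibility persists (open), there `holTo` is the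
mean `fedM δ_N` of the enumerated family = its analytic extension `fedMeanGc 0` (unitary family on the guard), and the family is a finite product of bond matrices.
[cite: Balaban1987RG1, (0.10)–(0.11) p.253 («we assume that it is an analytic function»)] -/
theorem contDiffAt_coe_holTo_comp_of_adm {Φ : E → GaugeField P j (SU N)} {x₀ : E} (hΦc : ContinuousAt Φ x₀)
    (hΦ : ∀ b : PBond P j, ContDiffAt ℝ ⊤ (fun x => ((Φ x b : SU N) : Matrix (Fin N) (Fin N) ℂ)) x₀)
    (y : Site P (j + 1)) (x' : Site P j) (hadm : (federbushSU (n := Fin N)).Adm (stairHol (Φ x₀) y (offsetOf y x'))) :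
    ContDiffAt ℝ ⊤ (fun x => ((holTo (federbushSU (n := Fin N)) (Φ x) y x' : SU N) : Matrix (Fin N) (Fin N) ℂ)) x₀ := by
  set nn := offsetOf y x' with hnn
  set e := LoopAverage.enum (Equiv.Perm (Fin P.d)) with he
  -- the enumerated staircase family, read as matrices, along the chart
  set Ψ : E → (Fin (Fintype.card (Equiv.Perm (Fin P.d)) - 1 + 1) → Matrix (Fin N) (Fin N) ℂ) :=
    fun x i => ((stairHol (Φ x) y nn (e.symm i) : SU N) : Matrix (Fin N) (Fin N) ℂ) with hΨ
  -- (1) admissibility persists near `x₀`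
  have hev : ∀ᶠ x in 𝓝 x₀, (federbushSU (n := Fin N)).Adm (stairHol (Φ x) y nn) :=
    hΦc.preimage_mem_nhds ((N09GaugeFixingTermContinuousOnAdmissible.isOpen_setOf_adm_stairHol (N := N) y x').mem_nhds hadm)
  -- (2) on that neighbourhood `holTo` is `fedMeanGc 0` of the enumerated family
  have hguard : ∀ {x : E}, (federbushSU (n := Fin N)).Adm (stairHol (Φ x) y nn) →
      ∀ i k : Fin (Fintype.card (Equiv.Perm (Fin P.d)) - 1 + 1), ‖Ψ x i * star (Ψ x k) - 1‖ < deltaFed (Fin N) := by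
    intro x hx i k
    have h := (N09GaugeFixingTermContinuousOnAdmissible.adm_federbushSU_iff (stairHol (Φ x) y nn)).1 hx (e.symm i) (e.symm k)
    simpa only [hΨ] using h
  have hunit : ∀ (x : E) (i : Fin (Fintype.card (Equiv.Perm (Fin P.d)) - 1 + 1)), Ψ x i ∈ Matrix.unitaryGroup (Fin N) ℂ :=
    fun x i => (Matrix.mem_specialUnitaryGroup_iff.mp (stairHol (Φ x) y nn (e.symm i)).2).1
  have hEq : (fun x => ((holTo (federbushSU (n := Fin N)) (Φ x) y x' : SU N) : Matrix (Fin N) (Fin N) ℂ)) =ᶠ[𝓝 x₀]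
      fun x => fedMeanGc 0 (Ψ x) := by
    filter_upwards [hev] with x hx
    have h1 : holTo (federbushSU (n := Fin N)) (Φ x) y x' = (federbushSU (n := Fin N)).M (stairHol (Φ x) y nn ∘ e.symm) := by
      rw [holTo_of_adm _ _ _ _ hx]; rfl
    rw [h1]
    show ((fedMSU (stairHol (Φ x) y nn ∘ e.symm) : SU N) : Matrix (Fin N) (Fin N) ℂ) = fedMeanGc 0 (Ψ x)
    rw [coe_fedMSU]
    show fedM (deltaFed (Fin N)) (Ψ x) = fedMeanGc 0 (Ψ x)
    exact fedM_eq_fedMeanGc (hunit x) deltaFed_le (hguard hx)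
  -- (3) the enumerated family is `C^∞` along the chart (finite products of bond matrices)
  have hcoe : ContDiffAt ℝ ⊤ (fun x => coeField (Φ x)) x₀ := contDiffAt_pi.2 fun b => hΦ b
  have hΨs : ContDiffAt ℝ ⊤ Ψ x₀ := by
    refine contDiffAt_pi.2 fun i => ?_
    have hfun : (fun x => Ψ x i) = (fun V => holM V (walk (emb y) (stairWord (e.symm i) nn))) ∘ fun x => coeField (Φ x) := by
      funext x
      simp only [hΨ, Function.comp_apply, stairHol, coe_holAt]
    rw [hfun]
    exact (contDiff_holM _).contDiffAt.comp x₀ hcoe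
  -- (4) the analytic mean composed with the smooth family
  have hfed : ContDiffAt ℝ ⊤ (fedMeanGc 0 : (Fin (Fintype.card (Equiv.Perm (Fin P.d)) - 1 + 1) → Matrix (Fin N) (Fin N) ℂ) → Matrix (Fin N) (Fin N) ℂ) (Ψ x₀) := by
    have hadm₀ : (federbushSU (n := Fin N)).Adm (stairHol (Φ x₀) y nn) := hadm
    exact ((analyticAt_fedMeanGc_of_unitary (hunit x₀) deltaFed_le (hguard hadm₀)).contDiffAt).restrict_scalars ℝ
  exact (hfed.comp x₀ hΨs).congr_of_eventuallyEq hEq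

end Contour

/-! ## §2  Row (b): the gauge-fixing function of record along the chart is `C^∞` at `0` -/

section Record

variable (F : T4Family)

/-- `G(V′V^{(k)}) = Σ_y Σ_{x′ ∈ B(y)∖y} [1 − Re tr U(y,x′)(V′V^{(k)})]` — unfolding ✓`recordGf` ∕ ✓`gfOfRecord` ∕ `gaugeFixFn` along the chart, `Re tr` read as the real-linear functional `nReTrL` of the
matrix. [cite: Balaban1987RG1, (0.17)–(0.19) p.255, (2.5) p.266] -/
theorem recordGf_eq_sum (k K : ℕ) (Vk : GaugeField (F.P K) k (SU 2)) (x : FluctIdx F k K → ℝ) :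
    recordGf F k K Vk x = ∑ y : Site (F.P K) (k + 1), ∑ x' ∈ (block y).erase (emb y),
      (1 - T4AveragingDeficitWall.nReTrL (((holTo (federbushSU (n := Fin 2)) (pert F k K Vk x) y x' : SU 2) : MatA 2))) := rfl

/-- ★★ **ROW (b) — `recordGf Vk` IS `C^∞` AT `B′ = 0` WHENEVER EVERY STAIRCASE FAMILY OF `Vk` IS ADMISSIBLE**: each summand `1 − Re tr U(y,x′)(V′V^{(k)})` is `C^∞` at `0` by §1 along the chart
`x ↦ pert Vk x` (✓`continuous_pert`, ✓`contDiff_coe_pert_apply`, `pert Vk 0 = Vk`) composed with the real-linear `Re tr`. [cite: Balaban1987RG1, (2.5) p.266, (0.10)–(0.11) p.253, (0.19) p.255] -/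
theorem contDiffAt_recordGf_of_adm (k K : ℕ) (Vk : GaugeField (F.P K) k (SU 2))
    (hadm : ∀ y : Site (F.P K) (k + 1), ∀ x' ∈ block y, (federbushSU (n := Fin 2)).Adm (stairHol Vk y (offsetOf y x'))) :
    ContDiffAt ℝ ⊤ (recordGf F k K Vk) 0 := by
  have hfun : recordGf F k K Vk = fun x => ∑ y : Site (F.P K) (k + 1), ∑ x' ∈ (block y).erase (emb y),
      (1 - T4AveragingDeficitWall.nReTrL (((holTo (federbushSU (n := Fin 2)) (pert F k K Vk x) y x' : SU 2) : MatA 2))) :=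
    funext fun x => recordGf_eq_sum F k K Vk x
  rw [hfun]
  refine ContDiffAt.sum fun y _ => ContDiffAt.sum fun x' hx' => ?_
  have hx : x' ∈ block y := Finset.mem_of_mem_erase hx'
  have h0 : (federbushSU (n := Fin 2)).Adm (stairHol (pert F k K Vk 0) y (offsetOf y x')) := by
    rw [pert_zero]; exact hadm y x' hx
  have hbrick := contDiffAt_coe_holTo_comp_of_adm (N := 2) (Φ := pert F k K Vk) (x₀ := 0) (continuous_pert F k K Vk).continuousAt
    (fun b => (contDiff_coe_pert_apply F k K Vk b).contDiffAt) y x' h0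
  exact contDiffAt_const.sub ((T4AveragingDeficitWall.nReTrL (n := Fin 2)).contDiff.contDiffAt.comp 0 hbrick)

/-- ★★ **ROW (b) AT EVERY PLAQUETTE-SMALL BACKGROUND**: if `Vk` is `a`-plaquette-small with `((d·L)²∕4)·a < δ_N` (standing range `k + 1 ≤ m + K`) then every staircase family of `Vk` is admissible
(N09 ✓`adm_stairHol_of_plaqSmall`), so `recordGf Vk` is `C^∞` at `0`. [cite: Balaban1987RG1, (2.5) p.266, (0.11) p.253 («with sufficiently small diameters»)] -/
theorem contDiffAt_recordGf_of_plaqSmall (k K : ℕ) (hk : k + 1 ≤ (F.P K).m + (F.P K).K) (Vk : GaugeField (F.P K) k (SU 2)) {a : ℝ} (ha : 0 ≤ a)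
    (hV : PlaqSmall a Vk) (hnum : ((((F.P K).d * (F.P K).L : ℕ) : ℝ)) ^ 2 / 4 * a < deltaFed (Fin 2)) :
    ContDiffAt ℝ ⊤ (recordGf F k K Vk) 0 :=
  contDiffAt_recordGf_of_adm F k K Vk fun y _ hx => N09GaugeFixingTermContinuousOnAdmissible.adm_stairHol_of_plaqSmall hk ha hV hnum y hx

/-! ## §3  (M7-sym) re-keyed on the P0-ℝ row alone: every plaquette-small background; every point of the ε₀-class -/

/-- ★★ **SYMMETRY OF `recordPreckLoc` AT EVERY PLAQUETTE-SMALL, (0.4)-GUARDED BACKGROUND FROM THE P0-ℝ ROW ALONE**: ✓`isHermitian_recordPreckLoc_of_small` with its gauge-fixing `C²` row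
discharged by §2. [cite: Balaban1987RG1, (2.11) p.267, p.268, (2.5) p.266; Balaban1985Variational, Prop. 9 p.309] -/
theorem isHermitian_recordPreckLoc_of_plaqSmall_of_contDiffAt (k K : ℕ) (hk : k + 1 ≤ (F.P K).m + (F.P K).K) (εbg : ℝ) (Vk : GaugeField (F.P K) k (SU 2))
    {a : ℝ} (ha : 0 ≤ a) (hV : PlaqSmall a Vk) (hnum : ((((F.P K).d * (F.P K).L : ℕ) : ℝ)) ^ 2 / 4 * a < deltaFed (Fin 2))
    (hsmall : ∀ c : PBond (F.P K) (k + 1), Small expMeanLogSU Vk c) (hA : ContDiffAt ℝ 2 (recordAUk F k K εbg Vk) 0) :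
    (recordPreckLoc F k K εbg Vk (hopLinGraph F k K Vk)).IsHermitian :=
  isHermitian_recordPreckLoc_of_small F k K hk εbg Vk hsmall hA ((contDiffAt_recordGf_of_plaqSmall F k K hk Vk ha hV hnum).of_le le_top)

/-- `δ_{SU(2)} = 1∕100` (Federbush's radius `min (1∕100) (1∕(3N))` at `N = 2`). [folklore] -/
theorem deltaFed_fin_two : deltaFed (Fin 2) = 1 / 100 := by
  rw [deltaFed, Fintype.card_fin]
  norm_num

variable (a₀ ε₂₉ : ℝ) (Mc k n : ℕ) {ε₀ ε₁ : ℝ}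

/-- **On the class the Federbush numerics hold**: `((d·L)²∕4)·(2ε₀) = 8L²ε₀ < 1∕100 = δ_{SU(2)}` for `ε₀ ≤ 1∕(53581824·L⁶)`. [folklore] -/
theorem fedNumerics_of_classRadius (hc : ε₀ ≤ 1 / (53581824 * (F.L : ℝ) ^ 6)) :
    ((((F.P (recordK₀ F Mc k + n)).d * (F.P (recordK₀ F Mc k + n)).L : ℕ) : ℝ)) ^ 2 / 4 * (2 * ε₀) < deltaFed (Fin 2) := by
  rw [deltaFed_fin_two, T4Family.P_d, T4Family.P_L]
  have hL12 : (12 : ℝ) ≤ F.L := by exact_mod_cast F.hL11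
  have hL1 : (1 : ℝ) ≤ F.L := by linarith
  have hL4 : (1 : ℝ) ≤ (F.L : ℝ) ^ 4 := one_le_pow₀ hL1
  have hL6pos : (0 : ℝ) < 53581824 * (F.L : ℝ) ^ 6 := by positivity
  -- `8 L² ε₀ ≤ 8 L² ∕ (53581824 L⁶) = 8 ∕ (53581824 L⁴) < 1∕100`
  have h1 : (F.L : ℝ) ^ 2 * ε₀ ≤ (F.L : ℝ) ^ 2 * (1 / (53581824 * (F.L : ℝ) ^ 6)) := mul_le_mul_of_nonneg_left hc (by positivity)
  have h2 : (F.L : ℝ) ^ 2 * (1 / (53581824 * (F.L : ℝ) ^ 6)) = 1 / (53581824 * (F.L : ℝ) ^ 4) := by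
    field_simp
  have h3 : 1 / (53581824 * (F.L : ℝ) ^ 4) ≤ 1 / 53581824 := by
    apply div_le_div_of_nonneg_left zero_le_one (by norm_num)
    nlinarith
  push_cast
  nlinarith [h1, h2, h3]

/-- ★★★ **(M7-sym) AT EVERY POINT OF PRINT's ε₀-CLASS, MODULO THE ONE P0-ℝ ROW**: for `0 < ε₀ ≤ 1∕(53581824·L⁶)`, `2ε₀ ≤ ε₁`, TokE at `ε₁` (as ✓`…PortS1ClassTwins` displays it) and a class
point `B` (`InRegClass … ε₀ … B`), the (2.11) matrix `T(B) = recordPreckLoc F k K a₀ (portVkAx … B) (hopLinGraph … (portVkAx … B))` of `RegClassP5` is symmetric as soon as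
`x ↦ A(U_k(V′_x · V^{(k)}_{ax}(W_B)))` is `C²` at `x = 0` — the gauge-fixing row by §2 (✓`plaqSmall_portVkAx_of_inRegClass` + the class numerics), the (0.4) guard by
✓`small_portVkAx_of_inRegClass`. [cite: Balaban1987RG1, (2.11)–(2.12) pp.267–268, (1.1)–(1.2) p.260, (2.3) p.265; Balaban1985Variational, Prop. 9 p.309, Thm 1 p.279] -/
theorem isHermitian_recordPreckLoc_portVkAx_of_inRegClass (hε₀ : 0 < ε₀) (hc : ε₀ ≤ 1 / (53581824 * (F.L : ℝ) ^ 6)) (hε₁ : 2 * ε₀ ≤ ε₁)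
    (hTokE : ∀ V : GaugeField (F.P (recordK₀ F Mc k + n)) (k + 1) (SU 2), PlaqSmall ε₁ V →
      UkExists F 2 (recordK₀ F Mc k + n) (k + 1) a₀ V ∧ UniqueUkOrbit F 2 (recordK₀ F Mc k + n) (k + 1) a₀ V)
    {B : recordW F a₀ ε₂₉ k (recordK₀ F Mc k + n)} (hB : InRegClass F Mc k ε₀ a₀ ε₂₉ n B)
    (hA : ContDiffAt ℝ 2 (recordAUk F k (recordK₀ F Mc k + n) a₀ (portVkAx F a₀ ε₂₉ k (recordK₀ F Mc k + n) B)) 0) :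
    (recordPreckLoc F k (recordK₀ F Mc k + n) a₀ (portVkAx F a₀ ε₂₉ k (recordK₀ F Mc k + n) B)
      (hopLinGraph F k (recordK₀ F Mc k + n) (portVkAx F a₀ ε₂₉ k (recordK₀ F Mc k + n) B))).IsHermitian := by
  obtain ⟨h1, h2, -, -, -⟩ := classRadius_bounds F hε₀ hc
  exact isHermitian_recordPreckLoc_of_plaqSmall_of_contDiffAt F k (recordK₀ F Mc k + n) (succ_le_m_add_K_recordK₀ F Mc k n) a₀ _
    (by positivity : (0 : ℝ) ≤ 2 * ε₀) (plaqSmall_portVkAx_of_inRegClass F a₀ ε₂₉ Mc k n hε₀ h1 h2 hε₁ hTokE hB)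
    (fedNumerics_of_classRadius F Mc k n hc) (small_portVkAx_of_inRegClass F a₀ ε₂₉ Mc k n hε₀ hc hε₁ hTokE hB) hA

/-- ★★ **ROW (b) ITSELF AT EVERY CLASS POINT** (for the record: the gauge-fixing function along the chart over `V^{(k)}_{ax}(W_B)` is `C^∞` at `0`). [cite: Balaban1987RG1, (2.5) p.266, (2.3) p.265, (0.11) p.253] -/
theorem contDiffAt_recordGf_portVkAx_of_inRegClass (hε₀ : 0 < ε₀) (hc : ε₀ ≤ 1 / (53581824 * (F.L : ℝ) ^ 6)) (hε₁ : 2 * ε₀ ≤ ε₁)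
    (hTokE : ∀ V : GaugeField (F.P (recordK₀ F Mc k + n)) (k + 1) (SU 2), PlaqSmall ε₁ V →
      UkExists F 2 (recordK₀ F Mc k + n) (k + 1) a₀ V ∧ UniqueUkOrbit F 2 (recordK₀ F Mc k + n) (k + 1) a₀ V)
    {B : recordW F a₀ ε₂₉ k (recordK₀ F Mc k + n)} (hB : InRegClass F Mc k ε₀ a₀ ε₂₉ n B) :
    ContDiffAt ℝ ⊤ (recordGf F k (recordK₀ F Mc k + n) (portVkAx F a₀ ε₂₉ k (recordK₀ F Mc k + n) B)) 0 := by
  obtain ⟨h1, h2, -, -, -⟩ := classRadius_bounds F hε₀ hc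
  exact contDiffAt_recordGf_of_plaqSmall F k (recordK₀ F Mc k + n) (succ_le_m_add_K_recordK₀ F Mc k n) _ (by positivity : (0 : ℝ) ≤ 2 * ε₀)
    (plaqSmall_portVkAx_of_inRegClass F a₀ ε₂₉ Mc k n hε₀ h1 h2 hε₁ hTokE hB) (fedNumerics_of_classRadius F Mc k n hc)

end Record

end Summit.QuantumFields.YangMills.Theorems.BalabanUVNodesPortS1

end
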